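import Mathlib.Algebra.Group.Submonoid.Operations
import Literature.AlgebraicGeometry.Frobenioids.ElementaryFrobenioid
import HarnessLib

/-!
# Frobenioids I, §2: the Frobenius functor on `F_Φ` and the subfunctor `d · Φ`

Mochizuki, *The geometry of Frobenioids I*, Kyushu J. Math. **62** (2008).  Def. 1.1 (iii), p. 20:
"the assignment `Φ ↦ F_Φ` is functorial with respect to homomorphisms of functors [on `D`] valued
in monoids `Φ → Φ'`"; Prop. 2.1 (ii), p. 44: "the functor `F_Φ → F_Φ` — which we shall refer to as
the *Frobenius functor* on `F_Φ` — determined by the endomorphism of the functor `Φ` given by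
multiplication by `d`"; Def. 2.4 (iii), p. 48: the subfunctor `d · Φ(−) ⊆ Φ(−)` and "multiplication
by `d` on `Φ(−)` determines a *Frobenius functor* `F_Φ → F_Φ` which is compatible with Frobenius
degrees and the natural projection functor `F_Φ → D`".
[cite: MochizukiFrdI2008, Prop. 2.1(ii) p.44]

Contents: `ElemFrobenioid.isoMk` (isomorphisms of `F_Φ` over isomorphisms of `D`),
`ElemFrobenioid.mapEnd δ` (the functor `F_Φ → F_Φ` induced by an endomorphism `δ : Φ → Φ` of the
monoid `Φ` on `D` — identity on objects, `(f, Z, n) ↦ (f, δ(Z), n)`), the endomorphism `powEnd Φ d`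
("multiplication by `d ∈ ℕ_{≥1}`", multiplicatively the `d`-th power), the Frobenius functor
`frobenius Φ d := mapEnd (powEnd Φ d)` with its compatibilities, and the image subfunctor
`imageMonoid δ` (`d · Φ ⊆ Φ` for `δ = powEnd Φ d`).  For `Λ = ℚ, ℝ` (Def. 2.4 (ii)(iii)) the
endomorphism "multiplication by `d ∈ Λ_{>0}`" is supplied as a general `δ`.
Multiplicative notation as in `Monoids.lean`.
-/

noncomputable section

namespace Literature.AlgebraicGeometry.Frobenioids

open CategoryTheory Opposite

universe w v u

variable {D : Type u} [Category.{v} D] (Φ : Dᵒᵖ ⥤ CommMonCat.{w})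

/-! ### Endomorphisms of the monoid `Φ` on `D` -/

/-- "Multiplication by `d`" on `Φ(−)` for `d ∈ ℕ_{≥1}` (multiplicatively the `d`-th power maps),
as an endomorphism `Φ → Φ` of the functor `Φ` (natural because the pull-backs are homomorphisms).
[cite: MochizukiFrdI2008, Prop. 2.1(ii) p.44] -/
def powEnd (d : ℕ+) : Φ ⟶ Φ where
  app A := CommMonCat.ofHom (powMonoidHom (d : ℕ))
  naturality A B f := by
    apply CommMonCat.hom_ext
    ext x
    simp

/-- `powEnd Φ d` at `A` is `x ↦ d · x`. [cite: MochizukiFrdI2008, Prop. 2.1(ii) p.44] -/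
@[simp] theorem powEnd_app_apply (d : ℕ+) (A : Dᵒᵖ) (x : Φ.obj A) :
    ((powEnd Φ d).app A).hom x = x ^ (d : ℕ) := rfl

variable {Φ}

/-- An endomorphism `δ` of `Φ` commutes with the pull-back maps: `δ(f^* x) = f^*(δ x)`.
[cite: MochizukiFrdI2008, Def. 1.1(iii) p.20] -/
theorem end_app_pull (δ : Φ ⟶ Φ) {A B : D} (f : B ⟶ A) (x : Φ.obj (op A)) :
    (δ.app (op B)).hom (pull Φ f x) = pull Φ f ((δ.app (op A)).hom x) := by
  have h := congrArg (fun g => (CommMonCat.Hom.hom g) x) (δ.naturality f.op)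
  simp only [CommMonCat.hom_comp, MonoidHom.coe_comp, Function.comp_apply] at h
  exact h

/-- The image subfunctor of an endomorphism `δ : Φ → Φ`: `A ↦ δ(Φ(A)) ⊆ Φ(A)`; for `δ` =
multiplication by `d` this is "`d · Φ(−) ⊆ Φ(−)`" of Def. 2.4 (iii) (as a submonoid of each `Φ(A)`).
[cite: MochizukiFrdI2008, Def. 2.4(iii) p.48] -/
def imageSubmonoid (δ : Φ ⟶ Φ) (A : Dᵒᵖ) : Submonoid (Φ.obj A) := MonoidHom.mrange (δ.app A).hom

/-- Pull-backs preserve the image submonoids (naturality of `δ`). [cite: MochizukiFrdI2008, Def. 2.4(iii) p.48] -/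
theorem pull_mem_imageSubmonoid (δ : Φ ⟶ Φ) {A B : D} (f : B ⟶ A) {x : Φ.obj (op A)}
    (hx : x ∈ imageSubmonoid δ (op A)) : pull Φ f x ∈ imageSubmonoid δ (op B) := by
  obtain ⟨y, rfl⟩ := hx
  exact ⟨pull Φ f y, end_app_pull δ f y⟩

/-- The maps `Φ(f)` preserve the image submonoids (the same statement for arrows of `Dᵒᵖ`).
[cite: MochizukiFrdI2008, Def. 2.4(iii) p.48] -/
theorem map_mem_imageSubmonoid (δ : Φ ⟶ Φ) {A B : Dᵒᵖ} (f : A ⟶ B) {x : Φ.obj A}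
    (hx : x ∈ imageSubmonoid δ A) : (Φ.map f).hom x ∈ imageSubmonoid δ B := by
  obtain ⟨y, rfl⟩ := hx
  refine ⟨(Φ.map f).hom y, ?_⟩
  have h := congrArg (fun g => (CommMonCat.Hom.hom g) y) (δ.naturality f)
  simp only [CommMonCat.hom_comp, MonoidHom.coe_comp, Function.comp_apply] at h
  exact h

/-- The subfunctor `d · Φ ⊆ Φ` as a monoid on `D` in its own right (`A ↦ δ(Φ(A))`, pull-backs
restricted), so that one can speak of `F_{d·Φ}` (Def. 2.4 (iii); Prop. 2.5 (iii)(b)).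
[cite: MochizukiFrdI2008, Def. 2.4(iii) p.48] -/
def imageMonoid (δ : Φ ⟶ Φ) : Dᵒᵖ ⥤ CommMonCat.{w} where
  obj A := CommMonCat.of (imageSubmonoid δ A)
  map {A B} f := CommMonCat.ofHom (((Φ.map f).hom.restrict (imageSubmonoid δ A)).codRestrict
    (imageSubmonoid δ B) (fun x => map_mem_imageSubmonoid δ f x.2))
  map_id A := by
    apply CommMonCat.hom_ext; ext x
    simp
  map_comp f g := by
    apply CommMonCat.hom_ext; ext x
    simp

/-- The inclusion `d · Φ → Φ` of monoids on `D`. [cite: MochizukiFrdI2008, Def. 2.4(iii) p.48] -/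
def imageMonoidι (δ : Φ ⟶ Φ) : imageMonoid δ ⟶ Φ where
  app A := CommMonCat.ofHom (imageSubmonoid δ A).subtype
  naturality A B f := by apply CommMonCat.hom_ext; ext x; rfl

namespace ElemFrobenioid

variable (Φ)

/-- An isomorphism of `F_Φ` over an isomorphism `f : A_D ≅ B_D` of `D`: `(f, 0, 1)` with inverse
`(f⁻¹, 0, 1)`. [cite: MochizukiFrdI2008, Def. 1.1(iii) p.20] -/
def isoMk {A B : ElemFrobenioid Φ} (f : A.base ≅ B.base) : A ≅ B where
  hom := homMk f.hom 1 1
  inv := homMk f.inv 1 1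
  hom_inv_id := Hom.ext f.hom_inv_id
    (by
      show pull Φ f.hom 1 * 1 ^ ((1 : ℕ+) : ℕ) = 1
      rw [map_one, one_pow, mul_one])
    rfl
  inv_hom_id := Hom.ext f.inv_hom_id
    (by
      show pull Φ f.inv 1 * 1 ^ ((1 : ℕ+) : ℕ) = 1
      rw [map_one, one_pow, mul_one])
    rfl

variable {Φ}

/-- The functor `F_Φ → F_Φ` induced by an endomorphism `δ : Φ → Φ` of the monoid `Φ` on `D`
("`Φ ↦ F_Φ` is functorial with respect to homomorphisms of functors valued in monoids",
Def. 1.1 (iii)): identity on objects, `(φ_D, Z_φ, n_φ) ↦ (φ_D, δ(Z_φ), n_φ)`.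
[cite: MochizukiFrdI2008, Def. 1.1(iii) p.20] -/
def mapEnd (δ : Φ ⟶ Φ) : ElemFrobenioid Φ ⥤ ElemFrobenioid Φ where
  obj A := A
  map {A B} φ := homMk (Base φ) ((δ.app (op A.base)).hom (Div φ)) (degFr φ)
  map_id A := Hom.ext rfl (map_one _) rfl
  map_comp φ ψ := Hom.ext rfl
    (by
      show (δ.app _).hom (pull Φ (Base φ) (Div ψ) * Div φ ^ (degFr ψ : ℕ)) =
        pull Φ (Base φ) ((δ.app _).hom (Div ψ)) * ((δ.app _).hom (Div φ)) ^ (degFr ψ : ℕ)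
      rw [map_mul, map_pow, end_app_pull])
    rfl

/-- `mapEnd δ` is the identity on objects. [cite: MochizukiFrdI2008, Def. 1.1(iii) p.20] -/
@[simp] theorem mapEnd_obj (δ : Φ ⟶ Φ) (A : ElemFrobenioid Φ) : (mapEnd δ).obj A = A := rfl

/-- `mapEnd δ` preserves `Base`. [cite: MochizukiFrdI2008, Def. 1.1(iii) p.20] -/
@[simp] theorem base_mapEnd_map (δ : Φ ⟶ Φ) {A B : ElemFrobenioid Φ} (φ : A ⟶ B) :
    Base ((mapEnd δ).map φ) = Base φ := rfl

/-- `mapEnd δ` applies `δ` to `Div`. [cite: MochizukiFrdI2008, Def. 1.1(iii) p.20] -/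
@[simp] theorem div_mapEnd_map (δ : Φ ⟶ Φ) {A B : ElemFrobenioid Φ} (φ : A ⟶ B) :
    Div ((mapEnd δ).map φ) = (δ.app (op A.base)).hom (Div φ) := rfl

/-- `mapEnd δ` preserves `deg_Fr`. [cite: MochizukiFrdI2008, Def. 1.1(iii) p.20] -/
@[simp] theorem degFr_mapEnd_map (δ : Φ ⟶ Φ) {A B : ElemFrobenioid Φ} (φ : A ⟶ B) :
    degFr ((mapEnd δ).map φ) = degFr φ := rfl

/-- `mapEnd δ` commutes strictly with the projection `F_Φ → D`. [cite: MochizukiFrdI2008, Def. 2.4(iii) p.48] -/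
theorem mapEnd_comp_baseFunctor (δ : Φ ⟶ Φ) : mapEnd δ ⋙ baseFunctor Φ = baseFunctor Φ := rfl

variable (Φ)

/-- **The Frobenius functor on `F_Φ`** of degree `d ∈ ℕ_{≥1}`: "determined [cf. Def. 1.1 (iii)] by the
endomorphism of the functor `Φ` given by multiplication by `d`" (Prop. 2.1 (ii), p. 44;
Def. 2.4 (iii), p. 48): `(φ_D, Z_φ, n_φ) ↦ (φ_D, d · Z_φ, n_φ)`. [cite: MochizukiFrdI2008, Prop. 2.1(ii) p.44] -/
abbrev frobenius (d : ℕ+) : ElemFrobenioid Φ ⥤ ElemFrobenioid Φ := mapEnd (powEnd Φ d)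

/-- The Frobenius functor is the identity on objects. [cite: MochizukiFrdI2008, Prop. 2.1(ii) p.44] -/
@[simp] theorem frobenius_obj (d : ℕ+) (A : ElemFrobenioid Φ) : (frobenius Φ d).obj A = A := rfl

/-- The Frobenius functor on arrows: `Base` unchanged ("compatible with the natural projection
functor `F_Φ → D`", Def. 2.4 (iii)). [cite: MochizukiFrdI2008, Def. 2.4(iii) p.48] -/
@[simp] theorem base_frobenius_map (d : ℕ+) {A B : ElemFrobenioid Φ} (φ : A ⟶ B) :
    Base ((frobenius Φ d).map φ) = Base φ := rfl

/-- The Frobenius functor on arrows: `Div ↦ d · Div`. [cite: MochizukiFrdI2008, Prop. 2.1(ii) p.44] -/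
@[simp] theorem div_frobenius_map (d : ℕ+) {A B : ElemFrobenioid Φ} (φ : A ⟶ B) :
    Div ((frobenius Φ d).map φ) = Div φ ^ (d : ℕ) := rfl

/-- The Frobenius functor on arrows: `deg_Fr` unchanged ("compatible with Frobenius degrees",
Def. 2.4 (iii)). [cite: MochizukiFrdI2008, Def. 2.4(iii) p.48] -/
@[simp] theorem degFr_frobenius_map (d : ℕ+) {A B : ElemFrobenioid Φ} (φ : A ⟶ B) :
    degFr ((frobenius Φ d).map φ) = degFr φ := rfl

/-- The Frobenius functor commutes (strictly) with the projection `F_Φ → D` (Def. 2.4 (iii)).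
[cite: MochizukiFrdI2008, Def. 2.4(iii) p.48] -/
theorem frobenius_comp_baseFunctor (d : ℕ+) : frobenius Φ d ⋙ baseFunctor Φ = baseFunctor Φ := rfl

end ElemFrobenioid

end Literature.AlgebraicGeometry.Frobenioids
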